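import Literature.NumberTheory.Automorphic.PopaZagierHeckeElementPropertyA
import HarnessLib

/-!
# Popa–Zagier: pairing `T̃_n` with a conjugation-invariant function

For a function `F` on integer matrices that is invariant under sign and under conjugation by
`S` and `U` (e.g. a class function of `PSL₂(ℤ)`-conjugacy such as the number of fixed points of
`M` on `SL₂(ℤ)/Γ₀(N)`), the form (12) of the Popa–Zagier Hecke element,
`T̃ = −E + H + (X − SXS) + (Y − U²YU) + (Z − U²ZU)` (`propDecomp`), gives

  `∑_M c_n(M) F(M) = (1/6) (∑_{det M = n} w_H(M) F(M) − ∑_{det M = n} w_E(M) F(M))`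

(`finsum_coeffN_mul_eq`): the brackets `X, Y, Z` cancel against their conjugates, and the sign
normalisation doubles `E` and `H` (`w_E`, `w_H` are `12 ×` the weights of [PopaZagier2017, (12)],
supported on sign-normalised matrices).  This is the first step of the evaluation of
`tr(T̃_n | V)`, `V = ℚ[Γ₀(N)\SL₂(ℤ)]`, in [Popa2014, §2].  We also record the entry bounds
(`|entries| ≤ 2 det`) on the supports of the five brackets, whence all sums are finite.

## References
* [PopaZagier2017] A. Popa, D. Zagier, arXiv:1711.00327, §4 (12), Lemma 4.
* [Popa2014] A. Popa, Res. Math. Sci. 5 (2018), §2.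
-/

noncomputable section

open Matrix

namespace Literature.NumberTheory.Automorphic.PopaZagier

/-! ### Supports of the brackets of (12) -/

/-- Support of `E`. [cite: PopaZagier2017, §4 (12)] -/
theorem wE_ne_zero {a b c d : ℤ} (h : wE a b c d ≠ 0) :
    b < 0 ∧ 0 < c ∧ 0 ≤ a - d ∧ a - d ≤ -b ∧ a - d ≤ c := by
  unfold wE at h
  split_ifs at h <;> omega

/-- Support of `H`. [cite: PopaZagier2017, §4 (12)] -/
theorem wH_ne_zero {a b c d : ℤ} (h : wH a b c d ≠ 0) : c = 0 ∧ 0 < a ∧ a - d ≤ -b ∧ -b ≤ 0 := by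
  unfold wH chainWeight3 at h
  split_ifs at h <;> omega

/-- Support of `X`. [cite: PopaZagier2017, §4 (12)] -/
theorem wX_ne_zero {a b c d : ℤ} (h : wX a b c d ≠ 0) : b < 0 ∧ 0 < d ∧ 0 ≤ a - d ∧ -b ≤ c := by
  unfold wX at h
  split_ifs at h <;> omega

/-- Support of `Y`. [cite: PopaZagier2017, §4 (12)] -/
theorem wY_ne_zero {a b c d : ℤ} (h : wY a b c d ≠ 0) : 0 < c ∧ c < a ∧ a - d ≤ -b ∧ -b ≤ c := by
  unfold wY chainWeight3 at h
  split_ifs at h <;> omega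

/-- Support of `Z`. [cite: PopaZagier2017, §4 (12)] -/
theorem wZ_ne_zero {a b c d : ℤ} (h : wZ a b c d ≠ 0) : 0 < a ∧ 0 < c ∧ a - d ≤ c ∧ c ≤ -b := by
  unfold wZ chainWeight3 at h
  split_ifs at h <;> omega

/-- The shape of the entry bounds: positive determinant dominating twice every entry. [folklore] -/
def EntryBound (w : ℤ → ℤ → ℤ → ℤ → ℤ) : Prop :=
  ∀ a b c d, w a b c d ≠ 0 → 0 < a * d - b * c ∧ |a| ≤ 2 * (a * d - b * c) ∧
    |b| ≤ 2 * (a * d - b * c) ∧ |c| ≤ 2 * (a * d - b * c) ∧ |d| ≤ 2 * (a * d - b * c)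

/-- Entry bounds on the support of `H`. [cite: PopaZagier2017, Lemma 4(a)] -/
theorem entryBound_wH : EntryBound wH := by
  intro a b c d h
  obtain ⟨hc, ha, h1, h2⟩ := wH_ne_zero h
  subst hc
  have hd : a ≤ d := by omega
  have hb : 0 ≤ b := by omega
  rw [abs_of_pos ha, abs_of_nonneg hb, abs_zero, abs_of_pos (by omega : 0 < d)]
  have h3 : a ≤ a * d := by nlinarith
  have h4 : d ≤ a * d := by nlinarith
  refine ⟨by nlinarith, by nlinarith, by nlinarith, by nlinarith, by nlinarith⟩

/-- Entry bounds on the support of `X`. [cite: PopaZagier2017, Lemma 4(a)] -/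
theorem entryBound_wX : EntryBound wX := by
  intro a b c d h
  obtain ⟨hb, hd, had, hbc⟩ := wX_ne_zero h
  have ha : 0 < a := by omega
  have hc : 0 < c := by omega
  rw [abs_of_pos ha, abs_of_neg hb, abs_of_pos hc, abs_of_pos hd]
  have h1 : a ≤ a * d := by nlinarith
  have h2 : d ≤ a * d := by nlinarith
  have h3 : c ≤ -b * c := by nlinarith
  have h4 : -b ≤ -b * c := by nlinarith
  refine ⟨by nlinarith, by nlinarith, by nlinarith, by nlinarith, by nlinarith⟩

/-- Entry bounds on the support of `Y`. [cite: PopaZagier2017, Lemma 4(a)] -/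
theorem entryBound_wY : EntryBound wY := by
  intro a b c d h
  obtain ⟨hc, hca, h1, h2⟩ := wY_ne_zero h
  have ha : 0 < a := by omega
  have hd : 0 < d := by omega
  rw [abs_of_pos ha, abs_of_pos hc, abs_of_pos hd]
  rcases le_or_gt b 0 with hb | hb
  · rw [abs_of_nonpos hb]
    have hbc : 0 ≤ -b * c := mul_nonneg (by omega) hc.le
    have h3 : a ≤ a * d := by nlinarith
    have h4 : d ≤ a * d := by nlinarith
    refine ⟨by nlinarith, by nlinarith, by nlinarith, by nlinarith, by nlinarith⟩
  · rw [abs_of_pos hb]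
    have hda : a + b ≤ d := by omega
    have key : d * (a - c) + a * c ≤ a * d - b * c := by nlinarith
    have hac : 1 ≤ a - c := by omega
    have h3 : d ≤ d * (a - c) := by nlinarith
    refine ⟨by nlinarith, by nlinarith, by nlinarith, by nlinarith, by nlinarith⟩

/-- Entry bounds on the support of `Z`. [cite: PopaZagier2017, Lemma 4(a)] -/
theorem entryBound_wZ : EntryBound wZ := by
  intro a b c d h
  obtain ⟨ha, hc, h1, h2⟩ := wZ_ne_zero h
  have hb : b < 0 := by omega
  rw [abs_of_pos ha, abs_of_neg hb, abs_of_pos hc]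
  have hbc : c * c ≤ -b * c := by nlinarith
  rcases le_or_gt 0 d with hd | hd
  · rw [abs_of_nonneg hd]
    have had : 0 ≤ a * d := by positivity
    have h3 : d ≤ a * d := by nlinarith
    have h4 : a ≤ a * d + c := by
      rcases eq_or_lt_of_le hd with hd0 | hd0
      · subst hd0; omega
      · nlinarith
    refine ⟨by nlinarith, by nlinarith, by nlinarith, by nlinarith, by nlinarith⟩
  · rw [abs_of_neg hd]
    have hdc : -d ≤ c - a := by omega
    have hac : a ≤ c - 1 := by omega
    have e1 : a * (-d) ≤ (c - 1) * (c - 1) := by nlinarith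
    have hdet : 2 * c - 1 ≤ a * d - b * c := by nlinarith
    have e2 : (c - 1) * (c - 1) ≤ (c - 1) * (a * d - b * c) := by nlinarith
    have e3 : -b * c ≤ c * (a * d - b * c) := by nlinarith
    have e4 : -b ≤ a * d - b * c := le_of_mul_le_mul_right (by nlinarith) hc
    refine ⟨by nlinarith, by nlinarith, by nlinarith, by nlinarith, by nlinarith⟩

/-- Entry bounds on the support of `E`. [cite: PopaZagier2017, Lemma 4(a)] -/
theorem entryBound_wE : EntryBound wE := by
  intro a b c d h
  obtain ⟨hb, hc, had, h1, h2⟩ := wE_ne_zero h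
  rw [abs_of_neg hb, abs_of_pos hc]
  have hsq : (a - d) * (a - d) ≤ -b * c := by nlinarith
  have hbc1 : 1 ≤ -b * c := by nlinarith
  rcases le_or_gt 0 d with hd | hd
  · -- `0 ≤ d ≤ a`
    have ha : 0 ≤ a := by omega
    rw [abs_of_nonneg ha, abs_of_nonneg hd]
    have had0 : 0 ≤ a * d := by positivity
    have h3 : d ≤ a * d + (-b) * c := by
      rcases eq_or_lt_of_le hd with hd0 | hd0
      · subst hd0; nlinarith
      · nlinarith
    have h4 : a ≤ a * d + (-b) * c := by
      rcases eq_or_lt_of_le hd with hd0 | hd0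
      · subst hd0; nlinarith
      · nlinarith
    refine ⟨by nlinarith, by nlinarith, by nlinarith, by nlinarith, by nlinarith⟩
  · rw [abs_of_neg hd]
    rcases le_or_gt a 0 with ha | ha
    · -- `d < 0`, `a ≤ 0`
      rw [abs_of_nonpos ha]
      have had0 : 0 ≤ a * d := by nlinarith
      have h3 : -a ≤ -d := by omega
      have h4 : -d ≤ a * d + (-b) * c := by
        rcases eq_or_lt_of_le ha with ha0 | ha0
        · subst ha0; nlinarith
        · nlinarith
      refine ⟨by nlinarith, by nlinarith, by nlinarith, by nlinarith, by nlinarith⟩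
    · -- `d < 0 < a`: `det = (a + |d|)² - a|d| + (|b|c - (a-d)²) ≥ a² + a|d| + d²`
      rw [abs_of_pos ha]
      have key : a * a + a * (-d) + d * d ≤ a * d - b * c := by nlinarith
      have h3 : a ≤ a * a := by nlinarith
      have h4 : -d ≤ d * d := by nlinarith
      have h5 : a * (-d) ≤ a * d - b * c := by nlinarith
      refine ⟨by nlinarith, by nlinarith, by nlinarith, by nlinarith, by nlinarith⟩

/-! ### Bracket weights on `det = n` and finiteness -/

/-- A bracket weight restricted to `det M = n`, as a rational number. [folklore] -/
def bw (w : ℤ → ℤ → ℤ → ℤ → ℤ) (n : ℤ) (M : Mat) : ℚ :=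
  if M.det = n then (w (M 0 0) (M 0 1) (M 1 0) (M 1 1) : ℚ) else 0

/-- The box of matrices with entries bounded by `2n` is finite. [folklore] -/
theorem finite_box (n : ℤ) : {M : Mat | ∀ i j, |M i j| ≤ 2 * n}.Finite := by
  classical
  let box : Finset ℤ := Finset.Icc (-(2 * n)) (2 * n)
  let B : Finset Mat := (box ×ˢ box ×ˢ box ×ˢ box).image fun p => !![p.1, p.2.1; p.2.2.1, p.2.2.2]
  refine B.finite_toSet.subset fun M hM => ?_
  simp only [Set.mem_setOf_eq] at hM
  simp only [Finset.coe_image, Set.mem_image, Finset.mem_coe, Finset.mem_product, Finset.mem_Icc,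
    Prod.exists, B, box]
  refine ⟨M 0 0, M 0 1, M 1 0, M 1 1,
    ⟨abs_le.mp (hM 0 0), abs_le.mp (hM 0 1), abs_le.mp (hM 1 0), abs_le.mp (hM 1 1)⟩, ?_⟩
  ext i j
  fin_cases i <;> fin_cases j <;> rfl

/-- A bracket with entry bounds has finite support on `det = n`, against any `G`. [folklore] -/
theorem finite_support_bw {w : ℤ → ℤ → ℤ → ℤ → ℤ} (hw : EntryBound w) (n : ℤ) (G : Mat → ℚ) :
    (Function.support fun M => bw w n M * G M).Finite := by
  refine (finite_box n).subset fun M hM => ?_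
  simp only [Function.mem_support, ne_eq, mul_eq_zero, not_or, bw] at hM
  obtain ⟨h1, -⟩ := hM
  have hdet : M.det = n := by by_contra h; exact h1 (if_neg h)
  rw [if_pos hdet] at h1
  have hw' : w (M 0 0) (M 0 1) (M 1 0) (M 1 1) ≠ 0 := by exact_mod_cast h1
  obtain ⟨-, ha, hb, hc, hd⟩ := hw _ _ _ _ hw'
  have hdet' : M 0 0 * M 1 1 - M 0 1 * M 1 0 = n := by rw [← hdet, Matrix.det_fin_two]
  rw [hdet'] at ha hb hc hd
  intro i j
  fin_cases i <;> fin_cases j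
  · exact ha
  · exact hb
  · exact hc
  · exact hd

/-- The same after an injective change of variables in the matrix. [folklore] -/
theorem finite_support_bw_comp {w : ℤ → ℤ → ℤ → ℤ → ℤ} (hw : EntryBound w) (n : ℤ) (G : Mat → ℚ)
    (φ : Mat ≃ Mat) : (Function.support fun M => bw w n (φ M) * G M).Finite := by
  have h := finite_support_bw hw n (G ∘ φ.symm)
  have : (Function.support fun M => bw w n (φ M) * G M) =
      φ ⁻¹' (Function.support fun M => bw w n M * (G ∘ φ.symm) M) := by
    ext M; simp
  rw [this]
  exact h.preimage φ.injective.injOn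

/-! ### Conjugation by `S` and `U` -/

/-- `M ↦ S M S` (`= -S M S⁻¹`). [cite: PopaZagier2017, §4 (12)] -/
def conjS (M : Mat) : Mat := matS * M * matS

/-- `M ↦ U M U²` (`= -U M U⁻¹`). [cite: PopaZagier2017, §4 (12)] -/
def conjU (M : Mat) : Mat := matU * M * (matU * matU)

/-- `M ↦ U² M U`, the inverse of `conjU`. [folklore] -/
def conjU' (M : Mat) : Mat := matU * matU * M * matU

/-- Entries of `S M S`. [folklore] -/
theorem conjS_eq (M : Mat) : conjS M = !![-M 1 1, M 1 0; M 0 1, -M 0 0] := by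
  unfold conjS matS
  ext i j; fin_cases i <;> fin_cases j <;>
    simp [Matrix.mul_apply, Fin.sum_univ_two, Matrix.vecMul, dotProduct]

/-- Entries of `U M U²`. [folklore] -/
theorem conjU_eq (M : Mat) :
    conjU M = !![M 0 1 - M 1 1, M 1 1 - M 0 1 + M 1 0 - M 0 0; M 0 1, -M 0 0 - M 0 1] := by
  unfold conjU matU
  ext i j; fin_cases i <;> fin_cases j <;>
    simp [Matrix.mul_apply, Fin.sum_univ_two, Matrix.vecMul, dotProduct] <;> ring

/-- `S M S` is an involution. [folklore] -/
theorem conjS_conjS (M : Mat) : conjS (conjS M) = M := by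
  rw [conjS_eq, conjS_eq]
  ext i j; fin_cases i <;> fin_cases j <;> simp

/-- `U³ = -1`. [folklore] -/
theorem matU_cube : matU * matU * matU = -1 := by
  unfold matU
  ext i j; fin_cases i <;> fin_cases j <;> simp [Matrix.mul_apply, Fin.sum_univ_two]

/-- `U² (U M U²) U = M`. [folklore] -/
theorem conjU'_conjU (M : Mat) : conjU' (conjU M) = M := by
  unfold conjU conjU'
  calc matU * matU * (matU * M * (matU * matU)) * matU
      = (matU * matU * matU) * M * (matU * matU * matU) := by
        simp only [Matrix.mul_assoc]
    _ = M := by rw [matU_cube]; simp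

/-- `U (U² M U) U² = M`. [folklore] -/
theorem conjU_conjU' (M : Mat) : conjU (conjU' M) = M := by
  unfold conjU conjU'
  calc matU * (matU * matU * M * matU) * (matU * matU)
      = (matU * matU * matU) * M * (matU * matU * matU) := by
        simp only [Matrix.mul_assoc]
    _ = M := by rw [matU_cube]; simp

/-- `conjS` as a permutation of integer matrices. [folklore] -/
def conjSEquiv : Mat ≃ Mat := ⟨conjS, conjS, conjS_conjS, conjS_conjS⟩

/-- `conjU` as a permutation of integer matrices. [folklore] -/
def conjUEquiv : Mat ≃ Mat := ⟨conjU, conjU', conjU'_conjU, conjU_conjU'⟩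

/-- `det (S M S) = det M`. [folklore] -/
theorem det_conjS (M : Mat) : (conjS M).det = M.det := by
  rw [conjS_eq, Matrix.det_fin_two, Matrix.det_fin_two]; simp; ring

/-- `det (U M U²) = det M`. [folklore] -/
theorem det_conjU (M : Mat) : (conjU M).det = M.det := by
  rw [conjU_eq, Matrix.det_fin_two, Matrix.det_fin_two]; simp; ring

/-- A bracket evaluated at `S M S`. [folklore] -/
theorem bw_conjS (w : ℤ → ℤ → ℤ → ℤ → ℤ) (n : ℤ) (M : Mat) :
    bw w n (conjS M) = if M.det = n then (w (-M 1 1) (M 1 0) (M 0 1) (-M 0 0) : ℚ) else 0 := by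
  unfold bw; rw [det_conjS, conjS_eq]; simp

/-- A bracket evaluated at `U M U²`. [folklore] -/
theorem bw_conjU (w : ℤ → ℤ → ℤ → ℤ → ℤ) (n : ℤ) (M : Mat) :
    bw w n (conjU M) = if M.det = n then
      (w (M 0 1 - M 1 1) (M 1 1 - M 0 1 + M 1 0 - M 0 0) (M 0 1) (-M 0 0 - M 0 1) : ℚ) else 0 := by
  unfold bw; rw [det_conjU, conjU_eq]; simp

/-- A bracket evaluated at `-M`. [folklore] -/
theorem bw_neg (w : ℤ → ℤ → ℤ → ℤ → ℤ) (n : ℤ) (M : Mat) :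
    bw w n (-M) = if M.det = n then (w (-M 0 0) (-M 0 1) (-M 1 0) (-M 1 1) : ℚ) else 0 := by
  unfold bw
  rw [Matrix.det_neg]
  simp

/-! ### Sign normalisation doubles a normalised bracket -/

/-- If a bracket is supported on sign-normalised matrices, its sign normalisation is
`w(M) + w(-M)`. [cite: PopaZagier2017, §4] -/
theorem sgnNorm_eq_add {w : ℤ → ℤ → ℤ → ℤ → ℤ}
    (hw : ∀ a b c d, w a b c d ≠ 0 → 0 < c ∨ (c = 0 ∧ 0 < a)) (a b c d : ℤ) :
    sgnNorm w a b c d = w a b c d + w (-a) (-b) (-c) (-d) := by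
  unfold sgnNorm
  split_ifs with h
  · have : w (-a) (-b) (-c) (-d) = 0 := by
      by_contra h'
      have := hw _ _ _ _ h'
      omega
    rw [this, add_zero]
  · have : w a b c d = 0 := by
      by_contra h'
      exact h (hw _ _ _ _ h')
    rw [this, zero_add]

/-! ### The pairing -/

section Pairing

variable {n : ℤ} (F : Mat → ℚ)

/-- `∑ bw w (φ M) F M = ∑ bw w M F M` for an `F`-preserving permutation `φ`. [folklore] -/
theorem finsum_bw_comp_equiv (w : ℤ → ℤ → ℤ → ℤ → ℤ) (n : ℤ) (φ : Mat ≃ Mat)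
    (hF : ∀ M, F (φ M) = F M) :
    ∑ᶠ M, bw w n (φ M) * F M = ∑ᶠ M, bw w n M * F M := by
  calc ∑ᶠ M, bw w n (φ M) * F M = ∑ᶠ M, bw w n (φ M) * F (φ M) := by
        simp only [hF]
    _ = ∑ᶠ M, bw w n M * F M := finsum_comp_equiv φ (f := fun M => bw w n M * F M)

/-- A sign-normalised bracket pairs to twice the bracket, for even `F`. [folklore] -/
theorem finsum_bw_sgnNorm {w : ℤ → ℤ → ℤ → ℤ → ℤ} (hw : EntryBound w)
    (hw' : ∀ a b c d, w a b c d ≠ 0 → 0 < c ∨ (c = 0 ∧ 0 < a)) (n : ℤ)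
    (hneg : ∀ M, F (-M) = F M) :
    ∑ᶠ M, bw (sgnNorm w) n M * F M = 2 * ∑ᶠ M, bw w n M * F M := by
  have hpt : ∀ M, bw (sgnNorm w) n M * F M = bw w n M * F M + bw w n (-M) * F M := by
    intro M
    rw [bw_neg]
    unfold bw
    split_ifs with h
    · rw [sgnNorm_eq_add hw']; push_cast; ring
    · ring
  have hfin' : (Function.support fun M => bw w n (-M) * F M).Finite := by
    have := finite_support_bw_comp hw n F (Equiv.neg Mat)
    simp only [Equiv.neg_apply] at this
    exact this
  rw [finsum_congr hpt, finsum_add_distrib (finite_support_bw hw n F) hfin']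
  have e : ∑ᶠ M, bw w n (-M) * F M = ∑ᶠ M, bw w n M * F M := by
    have := finsum_bw_comp_equiv F w n (Equiv.neg Mat) (fun M => hneg M)
    simp only [Equiv.neg_apply] at this
    exact this
  rw [e]; ring

/-- **Pairing `T̃_n` with a sign- and conjugation-invariant `F`**:
`∑_M c_n(M) F(M) = (1/6)(∑_{det = n} w_H F − ∑_{det = n} w_E F)`.
[cite: PopaZagier2017, §4 (12), Lemma 4; Popa2014, §2] -/
theorem finsum_coeffN_mul_eq (hneg : ∀ M, F (-M) = F M) (hS : ∀ M, F (matS * M * matS) = F M)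
    (hU : ∀ M, F (matU * M * (matU * matU)) = F M) :
    ∑ᶠ M, coeffN n M * F M =
      (1 / 6 : ℚ) * ((∑ᶠ M, bw wH n M * F M) - ∑ᶠ M, bw wE n M * F M) := by
  -- expand `c_n` through (12)
  have hpt : ∀ M, coeffN n M * F M = (1 / 12 : ℚ) *
      ((((((((- (bw (sgnNorm wE) n M * F M) + bw (sgnNorm wH) n M * F M)
        + bw (sgnNorm wX) n M * F M) - bw (sgnNorm wX) n (conjS M) * F M)
        + bw (sgnNorm wY) n M * F M) - bw (sgnNorm wY) n (conjU M) * F M)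
        + bw (sgnNorm wZ) n M * F M) - bw (sgnNorm wZ) n (conjU M) * F M)) := by
    intro M
    rw [bw_conjS, bw_conjU, bw_conjU]
    unfold coeffN coeff coeff12M bw
    split_ifs with h
    · rw [propDecomp, coeff12']
      push_cast
      ring
    · ring
  -- entry bounds of the sign-normalised brackets
  have hsn : ∀ {w : ℤ → ℤ → ℤ → ℤ → ℤ}, EntryBound w → EntryBound (sgnNorm w) := by
    intro w hw a b c d h
    unfold sgnNorm at h
    split_ifs at h
    · exact hw a b c d h
    · have := hw _ _ _ _ h
      simp only [abs_neg, neg_mul_neg] at this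
      exact this
  have fE := finite_support_bw (hsn entryBound_wE) n F
  have fH := finite_support_bw (hsn entryBound_wH) n F
  have fX := finite_support_bw (hsn entryBound_wX) n F
  have fY := finite_support_bw (hsn entryBound_wY) n F
  have fZ := finite_support_bw (hsn entryBound_wZ) n F
  have fXS : (Function.support fun M => bw (sgnNorm wX) n (conjS M) * F M).Finite :=
    finite_support_bw_comp (hsn entryBound_wX) n F conjSEquiv
  have fYU : (Function.support fun M => bw (sgnNorm wY) n (conjU M) * F M).Finite :=
    finite_support_bw_comp (hsn entryBound_wY) n F conjUEquiv
  have fZU : (Function.support fun M => bw (sgnNorm wZ) n (conjU M) * F M).Finite :=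
    finite_support_bw_comp (hsn entryBound_wZ) n F conjUEquiv
  have fC : (Function.support fun M => coeffN n M * F M).Finite :=
    (finite_support_coeffN n).subset (Function.support_mul_subset_left _ _)
  -- conjugates pair off
  have eXS : ∑ᶠ M, bw (sgnNorm wX) n (conjS M) * F M = ∑ᶠ M, bw (sgnNorm wX) n M * F M :=
    finsum_bw_comp_equiv F _ n conjSEquiv hS
  have eYU : ∑ᶠ M, bw (sgnNorm wY) n (conjU M) * F M = ∑ᶠ M, bw (sgnNorm wY) n M * F M :=
    finsum_bw_comp_equiv F _ n conjUEquiv hU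
  have eZU : ∑ᶠ M, bw (sgnNorm wZ) n (conjU M) * F M = ∑ᶠ M, bw (sgnNorm wZ) n M * F M :=
    finsum_bw_comp_equiv F _ n conjUEquiv hU
  -- pass to a common finite set
  classical
  let S : Finset Mat := fC.toFinset ∪ fE.toFinset ∪ fH.toFinset ∪ fX.toFinset ∪ fXS.toFinset ∪
    fY.toFinset ∪ fYU.toFinset ∪ fZ.toFinset ∪ fZU.toFinset
  have sub : ∀ {f : Mat → ℚ} (hf : (Function.support f).Finite), hf.toFinset ⊆ S →
      ∑ᶠ M, f M = ∑ M ∈ S, f M := fun hf hS =>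
    finsum_eq_sum_of_support_subset _ fun M hM => hS (hf.mem_toFinset.mpr hM)
  have mem : ∀ {T : Finset Mat} {M : Mat}, M ∈ T →
      (T = fC.toFinset ∨ T = fE.toFinset ∨ T = fH.toFinset ∨ T = fX.toFinset ∨ T = fXS.toFinset ∨
        T = fY.toFinset ∨ T = fYU.toFinset ∨ T = fZ.toFinset ∨ T = fZU.toFinset) → M ∈ S := by
    intro T M hM hT
    simp only [S, Finset.mem_union]
    rcases hT with rfl | rfl | rfl | rfl | rfl | rfl | rfl | rfl | rfl <;>
      simp only [hM, true_or, or_true]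
  rw [sub fC (fun M hM => mem hM (Or.inl rfl)), Finset.sum_congr rfl (fun M _ => hpt M),
    ← Finset.mul_sum]
  simp only [Finset.sum_add_distrib, Finset.sum_sub_distrib, Finset.sum_neg_distrib]
  rw [← sub fE (fun M hM => mem hM (Or.inr (Or.inl rfl))),
    ← sub fH (fun M hM => mem hM (Or.inr (Or.inr (Or.inl rfl)))),
    ← sub fX (fun M hM => mem hM (Or.inr (Or.inr (Or.inr (Or.inl rfl))))),
    ← sub fXS (fun M hM => mem hM (Or.inr (Or.inr (Or.inr (Or.inr (Or.inl rfl)))))),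
    ← sub fY (fun M hM => mem hM (Or.inr (Or.inr (Or.inr (Or.inr (Or.inr (Or.inl rfl))))))),
    ← sub fYU (fun M hM => mem hM (Or.inr (Or.inr (Or.inr (Or.inr (Or.inr (Or.inr (Or.inl rfl)))))))),
    ← sub fZ (fun M hM => mem hM (Or.inr (Or.inr (Or.inr (Or.inr (Or.inr (Or.inr (Or.inr (Or.inl rfl))))))))),
    ← sub fZU (fun M hM => mem hM (Or.inr (Or.inr (Or.inr (Or.inr (Or.inr (Or.inr (Or.inr (Or.inr rfl)))))))))]
  rw [eXS, eYU, eZU,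
    finsum_bw_sgnNorm F entryBound_wE (fun a b c d h => Or.inl (wE_ne_zero h).2.1) n hneg,
    finsum_bw_sgnNorm F entryBound_wH (fun a b c d h => Or.inr ⟨(wH_ne_zero h).1, (wH_ne_zero h).2.1⟩) n hneg]
  ring

end Pairing

end Literature.NumberTheory.Automorphic.PopaZagier

end
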